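import Summits.Schanuel.Schanuel.Theorems.ZilberEacRealLineSurfaceZeros
import Summits.Schanuel.Schanuel.Theorems.ZilberEacLineSurfaceDensity
import HarnessLib

/-!
# Non-split surfaces over a line of REAL IRRATIONAL slope, II: Zariski density

HONEST FRAMING.  Cell `pub-schanuel` (Zilber's Exponential-Algebraic Closedness, case ladder;
host summit Schanuel), seat 2, gen 18 (HANDOFF O67 (c)).  **`unprojectedDense_lineSurface_of_irrational`**:
`a ∈ ℝ ∖ ℚ`, `b ∈ ℂ`, `P ∈ ℂ[x; y₀, y₁]` irreducible whose TOP `x`-ROW `P_{N₀} ∈ ℂ[y₀, y₁]` (the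
leading coefficient of `P` read in `ℂ[y₀, y₁][x]`) has a zero in `(ℂˣ)²` ⟹ the exponential points of
`{x₁ = ax₀ + b, P(x₀; y₀, y₁) = 0} ⊆ ℂ² × ℂ²` are Zariski dense (rescaled windows + two-parameter
persistence + Kronecker give exponential points whose fibre coordinates accumulate at infinitely many
torus points; seat 1's diagonal lemma `unprojectedDense_of_tendsto_family`).  With torus fibres over
infinitely many base points the surface is in Mantova–Masser's case (`mmCase_lineSurface_of_irrational`:
the closure of the base is the line of IRRATIONAL slope `a`); example
`{x₁ = √2·x₀, y₁ = x₀(y₀ - 1)}` (`e^{√2 z} = z(e^z - 1)`): case ∧ dense.  Seat 1's product theorem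
(`unprojectedDense_lineCurveSurface`, `P ∈ ℂ[y₀, y₁]`) is the case `N₀ = 0`.  What is NOT covered:
top rows without torus zeros (a monomial top row, e.g. `y₁ = x₀y₀`, `y₀² + y₁² = x₀ + 2` over a real
line: the zeros leave every compact window); rational slopes (not free); Fib(3,2); EC(3,2).  NOT
Schanuel's conjecture (neither used nor implied; EAC ⇏ SC); `EC(3,2)` stays OPEN; classes of instances
of an OPEN question (PLMS 2024, §1 p. 5).
-/

noncomputable section

open Filter Topology Metric Set Complex MvPolynomial
open Literature.NumberTheory.Transcendental Literature.ModelTheory.Zilber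
open Literature.ModelTheory.ExponentialFields

set_option linter.dupNamespace false

namespace Summit.Schanuel.Schanuel.Theorems

/-! ## Part A. The case certificate over a line of irrational real slope -/

section Certificate

variable {a : ℝ} (b : ℂ) (P : MvPolynomial (Fin 3) ℂ)

/-- `m₀x + m₁(ax + b) ≡ c` with `m₀, m₁ ∈ ℤ` forces `m₀ = m₁ = 0` when `a ∉ ℚ`. [folklore] -/
theorem lineCoeffs_eq_zero_of_irrational (ha : Irrational a) (m₀ m₁ : ℤ) (c : ℂ)
    (h : ∀ x : ℂ, (m₀ : ℂ) * x + (m₁ : ℂ) * (((a : ℂ) * x + b)) = c) : m₀ = 0 ∧ m₁ = 0 := by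
  have h0 := h 0
  have h1 := h 1
  simp only [mul_zero, zero_add, mul_one] at h0 h1
  have hsum : (m₀ : ℂ) + (m₁ : ℂ) * (a : ℂ) = 0 := by linear_combination h1 - h0
  have hre : (m₀ : ℝ) + (m₁ : ℝ) * a = 0 := by
    have := congrArg Complex.re hsum
    simpa using this
  by_cases hm₁ : m₁ = 0
  · refine ⟨?_, hm₁⟩
    rw [hm₁, Int.cast_zero, zero_mul, add_zero] at hre
    exact_mod_cast hre
  · exfalso
    have hm₁' : (m₁ : ℝ) ≠ 0 := by exact_mod_cast hm₁
    refine (irrational_iff_ne_rational a).1 ha (-m₀) m₁ hm₁ ?_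
    rw [Int.cast_neg]
    field_simp
    linarith

/-- **The closure of the base is not a line of rational slope** (`a ∈ ℝ ∖ ℚ`; torus fibres over
infinitely many base points). (new) -/
theorem not_isRationalSlopeLine_lineSurface_of_irrational (ha : Irrational a)
    (hfib : Set.Infinite {t : ℂ | ∃ c : Fin 2 → ℂ, c 0 ≠ 0 ∧ c 1 ≠ 0 ∧
      MvPolynomial.eval ![t, c 0, c 1] P = 0}) :
    ¬ IsRationalSlopeLine (zeroLocus ℂ (vanishingIdeal ℂ
        (projAdd '' ({w : Fin 2 ⊕ Fin 2 → ℂ | w (Sum.inl 1) = (linePoly a b).eval (w (Sum.inl 0)) ∧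
          MvPolynomial.eval ![w (Sum.inl 0), w (Sum.inr 0), w (Sum.inr 1)] P = 0} ∩
          torusLocus ℂ 2)))) := by
  rw [vanishingIdeal_projAdd_graphSurface (linePoly a b) P hfib]
  exact not_isRationalSlopeLine_graphPolySurface _ Polynomial.X_ne_zero fun m₀ m₁ c h =>
    lineCoeffs_eq_zero_of_irrational b ha m₀ m₁ c fun x => by simpa only [eval_linePoly] using h x

/-- **Case certificate over a line of irrational real slope (non-split fibre).** (new) -/
theorem mmCase_lineSurface_of_irrational (ha : Irrational a) (hirr : Irreducible P)
    (hfib : Set.Infinite {t : ℂ | ∃ c : Fin 2 → ℂ, c 0 ≠ 0 ∧ c 1 ≠ 0 ∧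
      MvPolynomial.eval ![t, c 0, c 1] P = 0}) :
    MMCaseDimPiOneFree {w : Fin 2 ⊕ Fin 2 → ℂ | w (Sum.inl 1) = (linePoly a b).eval (w (Sum.inl 0)) ∧
        MvPolynomial.eval ![w (Sum.inl 0), w (Sum.inr 0), w (Sum.inr 1)] P = 0} := by
  obtain ⟨t, c, h0, h1, hc⟩ := hfib.nonempty
  exact ⟨isIrreducibleClosed_graphSurface _ hirr,
    ⟨_, elim_mem_graphSurface_inter_torusLocus (linePoly a b) P h0 h1 hc⟩,
    zariskiDim_graphSurface _ hirr, addProjDim_graphSurface (linePoly a b) P hfib,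
    not_isRationalSlopeLine_lineSurface_of_irrational b P ha hfib⟩

end Certificate

/-! ## Part B. Density -/

section Main

variable {a : ℝ} (b : ℂ) {P : MvPolynomial (Fin 3) ℂ}

/-- **Zariski density over a line of irrational real slope, non-split fibre.**  `a ∈ ℝ ∖ ℚ`,
`P ∈ ℂ[x; y₀, y₁]` irreducible, and the top `x`-row `P_{N₀} ∈ ℂ[y₀, y₁]` of `P` (its leading
coefficient in `ℂ[y₀, y₁][x]`) vanishes somewhere on `(ℂˣ)²` ⟹ the exponential points of
`{x₁ = ax₀ + b, P(x₀; y₀, y₁) = 0}` are Zariski dense.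
[cite: MantovaMasser2023, §1 Further remarks, p. 5 (the question, open in general)] (new) -/
theorem unprojectedDense_lineSurface_of_irrational (ha : Irrational a) (hirr : Irreducible P)
    (htop : ∃ c : Fin 2 → ℂ, c 0 ≠ 0 ∧ c 1 ≠ 0 ∧
      MvPolynomial.eval c (MvPolynomial.finSuccEquiv ℂ 2 P).leadingCoeff = 0) :
    UnprojectedDense {w : Fin 2 ⊕ Fin 2 → ℂ | w (Sum.inl 1) = (linePoly a b).eval (w (Sum.inl 0)) ∧
      MvPolynomial.eval ![w (Sum.inl 0), w (Sum.inr 0), w (Sum.inr 1)] P = 0} := by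
  have hP : (MvPolynomial.finSuccEquiv ℂ 2 P).leadingCoeff ≠ 0 := by
    rw [Ne, Polynomial.leadingCoeff_eq_zero, EmbeddingLike.map_eq_zero_iff]
    exact hirr.ne_zero
  obtain ⟨c, B, hcinj, hcB, hacc⟩ := exists_lineSurface_accumulation_family ha b P htop hP
  choose z hz0 hzinf hzlim using hacc
  obtain ⟨j₀, hj₀⟩ := rf_exists_coord_range_infinite hcinj
  have hS := isIrreducibleClosed_graphSurface (linePoly a b) hirr
  have hdim := zariskiDim_graphSurface (linePoly a b) hirr
  refine unprojectedDense_of_tendsto_family hS (by rw [hdim]) j₀ (fun i k => rfLinePt a b (z i k))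
    (fun i k => ?_) (fun i k => rfLinePt_mem_expGraph a b _) ?_ (fun i => c i j₀) ?_ (B := B)
    (fun i => hcB i j₀) hj₀
  · refine ⟨by simp, ?_⟩
    have e : (![rfLinePt a b (z i k) (Sum.inl 0), rfLinePt a b (z i k) (Sum.inr 0),
        rfLinePt a b (z i k) (Sum.inr 1)] : Fin 3 → ℂ) = Fin.cons (z i k) (rfPt a b 1 (z i k)) := by
      funext j
      refine Fin.cases ?_ (fun j' => ?_) j
      · simp
      · fin_cases j' <;> simp [rfPt]
    rw [e]
    exact hz0 i k
  · intro i
    fin_cases j₀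
    · simpa using hzinf i
    · have ha0 : (0 : ℝ) < |a| := abs_pos.2 ha.ne_zero
      have hlow : ∀ k, |a| * ‖z i k‖ + -‖b‖ ≤ ‖(a : ℂ) * z i k + b‖ := fun k => by
        have h1 := norm_sub_le ((a : ℂ) * z i k + b) b
        rw [add_sub_cancel_right, norm_mul, Complex.norm_real, Real.norm_eq_abs] at h1
        linarith
      have hlim : Tendsto (fun k => |a| * ‖z i k‖ + -‖b‖) atTop atTop :=
        tendsto_atTop_add_const_right _ _ ((hzinf i).const_mul_atTop ha0)
      simpa using tendsto_atTop_mono hlow hlim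
  · intro i
    have e : (fun k => rfLinePt a b (z i k) (Sum.inr j₀)) =
        ((fun p : Fin 2 → ℂ => p j₀) ∘ fun k => rfPt a b 1 (z i k)) := by
      funext k; simp
    rw [e]
    exact ((continuous_apply j₀).tendsto (c i)).comp (hzlim i)

/-- **Mantova–Masser's question over a line of irrational real slope, non-split fibre: case ∧
dense** (torus fibres over infinitely many base points; top row with a torus zero).
[cite: MantovaMasser2023, §1 Further remarks, p. 5 (the question, open in general)] (new) -/
theorem unprojectedDensityQuestion_instance_lineSurface_of_irrational (ha : Irrational a)
    (hirr : Irreducible P)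
    (htop : ∃ c : Fin 2 → ℂ, c 0 ≠ 0 ∧ c 1 ≠ 0 ∧
      MvPolynomial.eval c (MvPolynomial.finSuccEquiv ℂ 2 P).leadingCoeff = 0)
    (hfib : Set.Infinite {t : ℂ | ∃ c : Fin 2 → ℂ, c 0 ≠ 0 ∧ c 1 ≠ 0 ∧
      MvPolynomial.eval ![t, c 0, c 1] P = 0}) :
    MMCaseDimPiOneFree {w : Fin 2 ⊕ Fin 2 → ℂ | w (Sum.inl 1) = (linePoly a b).eval (w (Sum.inl 0)) ∧
        MvPolynomial.eval ![w (Sum.inl 0), w (Sum.inr 0), w (Sum.inr 1)] P = 0} ∧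
      UnprojectedDense {w : Fin 2 ⊕ Fin 2 → ℂ | w (Sum.inl 1) = (linePoly a b).eval (w (Sum.inl 0)) ∧
        MvPolynomial.eval ![w (Sum.inl 0), w (Sum.inr 0), w (Sum.inr 1)] P = 0} :=
  ⟨mmCase_lineSurface_of_irrational b P ha hirr hfib,
    unprojectedDense_lineSurface_of_irrational b ha hirr htop⟩

end Main

/-! ## Part C. Example: `{x₁ = √2·x₀, y₁ = x₀(y₀ - 1)}` (`e^{√2 z} = z(e^z - 1)`) -/

section Example

/-- `y₁ - x₀(y₀ - 1)` as a cyclic-cover polynomial of exponent `1`. -/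
theorem rlsd_PC_eq_cyclicCoverPoly :
    (X 2 - X 0 * (X 1 - 1) : MvPolynomial (Fin 3) ℂ) =
      cyclicCoverPoly 1 (X 0 * (X 1 - 1) : MvPolynomial (Fin 2) ℂ) := by
  rw [cyclicCoverPoly, pow_one, map_mul, map_sub, rename_X, rename_X, map_one]
  rfl

/-- **`y₁ - x₀(y₀ - 1)` is irreducible** (`x₀(y₀ - 1)` has the simple prime factor `x₀`). -/
theorem irreducible_PC : Irreducible (X 2 - X 0 * (X 1 - 1) : MvPolynomial (Fin 3) ℂ) := by
  rw [rlsd_PC_eq_cyclicCoverPoly]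
  refine irreducible_cyclicCoverPoly one_pos (π := X 0) MvPolynomial.X_prime
    (dvd_mul_right _ _) ?_
  rintro ⟨u, hu⟩
  have h1 : (X 1 - 1 : MvPolynomial (Fin 2) ℂ) = X 0 * u := by
    have h2 : (X 0 : MvPolynomial (Fin 2) ℂ) * (X 1 - 1) = X 0 * (X 0 * u) := by rw [hu]; ring
    exact mul_left_cancel₀ (MvPolynomial.X_ne_zero 0) h2
  have h3 := congrArg (MvPolynomial.eval ![(0 : ℂ), 0]) h1
  simp at h3

/-- The top `x`-row of `y₁ - x₀(y₀ - 1)` is `1 - y₀`, which vanishes at the torus point `(1, 1)`. -/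
theorem PC_topRow_torusZero :
    ∃ c : Fin 2 → ℂ, c 0 ≠ 0 ∧ c 1 ≠ 0 ∧
      MvPolynomial.eval c (MvPolynomial.finSuccEquiv ℂ 2
        (X 2 - X 0 * (X 1 - 1) : MvPolynomial (Fin 3) ℂ)).leadingCoeff = 0 := by
  have hQ : MvPolynomial.finSuccEquiv ℂ 2 (X 2 - X 0 * (X 1 - 1) : MvPolynomial (Fin 3) ℂ) =
      Polynomial.C (1 - X 0 : MvPolynomial (Fin 2) ℂ) * Polynomial.X + Polynomial.C (X 1) := by
    rw [map_sub, map_mul, map_sub, map_one,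
      show (2 : Fin 3) = Fin.succ 1 from rfl, show (1 : Fin 3) = Fin.succ 0 from rfl,
      MvPolynomial.finSuccEquiv_X_succ, MvPolynomial.finSuccEquiv_X_succ,
      MvPolynomial.finSuccEquiv_X_zero, map_sub, map_one]
    ring
  have hne : (1 - X 0 : MvPolynomial (Fin 2) ℂ) ≠ 0 := by
    intro h
    have := congrArg (MvPolynomial.eval ![(0 : ℂ), 0]) h
    simp at this
  refine ⟨![1, 1], by simp, by simp, ?_⟩
  rw [hQ, Polynomial.leadingCoeff_linear hne]
  simp

/-- Torus fibres of `y₁ = x₀(y₀ - 1)` over every `t ≠ 0` (`y₀ = 2`, `y₁ = t`). -/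
theorem PC_torusFibres_infinite :
    Set.Infinite {t : ℂ | ∃ c : Fin 2 → ℂ, c 0 ≠ 0 ∧ c 1 ≠ 0 ∧
      MvPolynomial.eval ![t, c 0, c 1] (X 2 - X 0 * (X 1 - 1) : MvPolynomial (Fin 3) ℂ) = 0} := by
  refine ((Set.finite_singleton (0 : ℂ)).infinite_compl).mono ?_
  intro t ht
  refine ⟨![2, t], by simp, by simpa using ht, ?_⟩
  simp
  ring

/-- **Example.**  `{x₁ = √2·x₀, y₁ = x₀(y₀ - 1)} ⊆ ℂ² × ℂ²` is in Mantova–Masser's case and its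
exponential points `(z, √2 z, e^z, e^{√2 z})` with `e^{√2 z} = z(e^z - 1)` are Zariski dense. (new) -/
theorem unprojectedDensityQuestion_instance_sqrtTwoLine_y1_eq_x0_mul :
    MMCaseDimPiOneFree {w : Fin 2 ⊕ Fin 2 → ℂ |
        w (Sum.inl 1) = (linePoly (Real.sqrt 2 : ℝ) 0).eval (w (Sum.inl 0)) ∧
        MvPolynomial.eval ![w (Sum.inl 0), w (Sum.inr 0), w (Sum.inr 1)]
          (X 2 - X 0 * (X 1 - 1) : MvPolynomial (Fin 3) ℂ) = 0} ∧
      UnprojectedDense {w : Fin 2 ⊕ Fin 2 → ℂ |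
        w (Sum.inl 1) = (linePoly (Real.sqrt 2 : ℝ) 0).eval (w (Sum.inl 0)) ∧
        MvPolynomial.eval ![w (Sum.inl 0), w (Sum.inr 0), w (Sum.inr 1)]
          (X 2 - X 0 * (X 1 - 1) : MvPolynomial (Fin 3) ℂ) = 0} :=
  unprojectedDensityQuestion_instance_lineSurface_of_irrational 0 irrational_sqrt_two
    irreducible_PC PC_topRow_torusZero PC_torusFibres_infinite

end Example

end Summit.Schanuel.Schanuel.Theorems
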